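import Summits.ResolutionOfSingularities.ResolutionOfSingularities.Theorems.FrobeniusLadderFRationalResolutionAnRegularOffOrigin
import Summits.ResolutionOfSingularities.ResolutionOfSingularities.Theorems.FrobeniusLadderFRationalResolutionChartGraphPow
import Summits.ResolutionOfSingularities.ResolutionOfSingularities.Theorems.FrobeniusLadderFRationalResolutionCoverSq
import Literature.AlgebraicGeometry.Resolution.AffineBlowupCartier
import Literature.AlgebraicGeometry.Resolution.AffineBlowupRegular
import Literature.AlgebraicGeometry.Resolution.ResolutionGlue
import Literature.AlgebraicGeometry.Resolution.ProjectiveSpaceRegular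
import HarnessLib

/-!
# The `A_n` programme for rung 4′, base: charts of the point blow-up, the cases `n = 0, 1`

Support file for crux stmt-ResolutionOfSingularities-15317 (`FrobeniusLadder.FRationalResolution`),
line `Sketch`, continuation seat c3. Rung 4′ (weakly F-regular ⇒ resolvable) is VERIFIED on the
whole family `Aₙ = Spec k[y,z,x]/(yz + x^(n+1))` (every field `k`; members of the residual class by
the c2 calibration) by the TOWER OF POINT BLOW-UPS. The induction runs on the sharper statement

  `P(n)`: there is a proper `π : X' → Aₙ` from a regular scheme which is an ISOMORPHISM OVER the
  complement `Uₙ = D(ȳ) ∪ D(z̄) ∪ D(x̄)` of the origin, with `π⁻¹(Uₙ)` dense,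

and descends `n + 2 ↦ n` through the `x`-chart of the blow-up of the origin (file
`…AnResolutionStep.lean`). This file: the pieces that do not need the step.

* `An_graphChart_isRegularRing` — for `n ≥ 1` the `y`- and `z`-charts `R[I/y]`, `R[I/z]` of the
  blow-up of `I = (x, y, z)` are regular rings (`stub_chart_graph_pow`, test maps by
  `Ideal.Quotient.liftₐ`);
* `An_isIso_affineBlowup_restrict_offOrigin`, `An_dense_preimage_offOrigin` — the blow-up is an
  isomorphism over `Uₙ` and `π⁻¹(Uₙ)` is dense;
* `An_offOrigin_resolution_one` — `P(1)` (the quadric cone: the blow-up itself is regular; the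
  `x`-chart is covered by the `y`-chart, `stub_cover_sq`);
* `An_zero_isRegular`, `An_offOrigin_resolution_zero` — `A₀ = {yz + x = 0}` is regular (the
  derivative `∂/∂x` of the equation is `1`), so `P(0)` holds with the identity;
* `An_hasResolution_of_offOrigin_resolution` — `P(n) ⇒ Scheme.HasResolution Aₙ` (`Uₙ` is dense).

All folklore (Kollár 2007 §2.2; Hartshorne II.7; Stacks 0804); no published fact is used.
-/

-- single-problem summit: the doubled namespace component is forced
set_option linter.dupNamespace false

noncomputable section

namespace Summit.ResolutionOfSingularities.ResolutionOfSingularities.Theorems.FRationalResolution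

open CategoryTheory AlgebraicGeometry TopologicalSpace MvPolynomial
open Literature.AlgebraicGeometry.Resolution

section AnBase

variable (k : Type) [Field k]

/-- The equation `gₙ = yz + x^(n+1)` of `Aₙ` in `k[y, z, x] = MvPolynomial (Fin 2 ⊕ Fin 1) k`. -/
local notation3 "gA[" n "]" => (X (Sum.inl 0) * X (Sum.inl 1) + rename Sum.inr (X 0 ^ (n + 1)) :
  MvPolynomial (Fin 2 ⊕ Fin 1) k)

/-- The coordinate ring `Rₙ = k[y,z,x]/(gₙ)` of `Aₙ`. -/
local notation3 "RA[" n "]" => MvPolynomial (Fin 2 ⊕ Fin 1) k ⧸ Ideal.span {gA[n]}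

/-- The class of a polynomial in `Rₙ`. -/
local notation3 "mkA[" n "]" => Ideal.Quotient.mk (Ideal.span {gA[n]})

/-- The complement `Uₙ = D(ȳ) ∪ D(z̄) ∪ D(x̄)` of the origin, an open of `Aₙ = Spec Rₙ`. -/
local notation3 "UA[" n "]" => ((PrimeSpectrum.basicOpen (mkA[n] (X (Sum.inl 0))) ⊔
    PrimeSpectrum.basicOpen (mkA[n] (X (Sum.inl 1))) ⊔
    PrimeSpectrum.basicOpen (mkA[n] (X (Sum.inr 0)))) : (Spec (CommRingCat.of RA[n])).Opens)

/-- The relation `ȳ z̄ + x̄^(n+1) = 0` in `Rₙ`. [folklore] -/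
theorem An_rel (n : ℕ) :
    mkA[n] (X (Sum.inl 0)) * mkA[n] (X (Sum.inl 1)) + mkA[n] (X (Sum.inr 0)) ^ (n + 1) = 0 := by
  have : mkA[n] gA[n] = 0 := Ideal.Quotient.eq_zero_iff_mem.mpr (Ideal.mem_span_singleton_self _)
  simpa [map_add, map_mul, map_pow, rename_X] using this

/-- `Rₙ` is a domain (`gₙ` is prime, `isPrime_span_suspension`). [folklore] -/
theorem An_isDomain (n : ℕ) : IsDomain RA[n] := by
  haveI : (Ideal.span {gA[n]}).IsPrime :=
    isPrime_span_suspension k 1 (X 0 ^ (n + 1)) (pow_ne_zero _ (X_ne_zero 0))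
  exact Ideal.Quotient.isDomain _

/-- A `k`-algebra map out of `k[y, z, x]` killing `gₙ` kills the ideal `(gₙ)`. [folklore] -/
theorem An_lift_aux (n : ℕ) {B : Type} [CommRing B] [Algebra k B]
    (θ₀ : MvPolynomial (Fin 2 ⊕ Fin 1) k →ₐ[k] B) (h0 : θ₀ gA[n] = 0) :
    ∀ s ∈ Ideal.span {gA[n]}, θ₀ s = 0 := by
  intro s hs
  obtain ⟨r, rfl⟩ := Ideal.mem_span_singleton'.mp hs
  rw [map_mul, h0, mul_zero]

/-- **The `y`-chart of the blow-up of `Aₙ` at the origin is regular** (`n ≥ 1`): with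
`I = (x̄, ȳ, z̄)`, `Rₙ[I/ȳ]` is a regular ring (an affine plane, `stub_chart_graph_pow`, the test
map `Rₙ → k[Y, X'][1/Y]` being `y ↦ Y, x ↦ X'Y, z ↦ −X'^(n+1)Yⁿ`). [folklore] -/
theorem An_graphChart_isRegularRing_y (n : ℕ) (hn : 1 ≤ n) :
    IsRegularRing (blowupAlgebra (Ideal.span {mkA[n] (X (Sum.inr 0)), mkA[n] (X (Sum.inl 0)),
        mkA[n] (X (Sum.inl 1))}) (mkA[n] (X (Sum.inl 0)))) := by
  set xb := mkA[n] (X (Sum.inr 0)) with hxb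
  set yb := mkA[n] (X (Sum.inl 0)) with hyb
  set zb := mkA[n] (X (Sum.inl 1)) with hzb
  have hrel : yb * zb + xb ^ (n + 1) = 0 := An_rel k n
  have hgen : Algebra.adjoin k {xb, yb, zb} = ⊤ := adjoin_mk_X_eq_top k gA[n]
  set u₀ := algebraMap (MvPolynomial (Fin 2) k)
    (Localization.Away (MvPolynomial.X 0 : MvPolynomial (Fin 2) k)) (X 0) with hu₀
  set u₁ := algebraMap (MvPolynomial (Fin 2) k)
    (Localization.Away (MvPolynomial.X 0 : MvPolynomial (Fin 2) k)) (X 1) with hu₁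
  set θy₀ : MvPolynomial (Fin 2 ⊕ Fin 1) k →ₐ[k]
      Localization.Away (MvPolynomial.X 0 : MvPolynomial (Fin 2) k) :=
    aeval (Sum.elim ![u₀, -(u₁ ^ (n + 1) * u₀ ^ n)] ![u₁ * u₀]) with hθy₀
  have hθy₀y : θy₀ (X (Sum.inl 0)) = u₀ := by simp [hθy₀]
  have hθy₀z : θy₀ (X (Sum.inl 1)) = -(u₁ ^ (n + 1) * u₀ ^ n) := by simp [hθy₀]
  have hθy₀x : θy₀ (X (Sum.inr 0)) = u₁ * u₀ := by simp [hθy₀]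
  have hθy₀g : θy₀ gA[n] = 0 := by
    rw [map_add, map_mul, hθy₀y, hθy₀z, aeval_rename, map_pow, Function.comp_def, aeval_X,
      Sum.elim_inr, Matrix.cons_val_zero]
    ring
  set θy := Ideal.Quotient.liftₐ (Ideal.span {gA[n]}) θy₀ (An_lift_aux k n θy₀ hθy₀g) with hθy
  have hθy_mk : ∀ s, θy (mkA[n] s) = θy₀ s := fun s =>
    AlgHom.congr_fun (Ideal.Quotient.liftₐ_comp (Ideal.span {gA[n]}) θy₀
      (An_lift_aux k n θy₀ hθy₀g)) s
  refine stub_chart_graph_pow k RA[n] n hn xb yb zb hrel hgen θy ?_ ?_ ?_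
  · rw [hyb, hθy_mk, hθy₀y]
  · rw [hxb, hθy_mk, hθy₀x, map_mul]
  · rw [hzb, hθy_mk, hθy₀z, map_mul, map_pow, map_pow]

/-- **The `z`-chart of the blow-up of `Aₙ` at the origin is regular** (`n ≥ 1`): the mirror
image of `An_graphChart_isRegularRing_y` (the equation is symmetric in `y, z`; test map
`z ↦ Y, x ↦ X'Y, y ↦ −X'^(n+1)Yⁿ`). [folklore] -/
theorem An_graphChart_isRegularRing_z (n : ℕ) (hn : 1 ≤ n) :
    IsRegularRing (blowupAlgebra (Ideal.span {mkA[n] (X (Sum.inr 0)), mkA[n] (X (Sum.inl 0)),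
        mkA[n] (X (Sum.inl 1))}) (mkA[n] (X (Sum.inl 1)))) := by
  set xb := mkA[n] (X (Sum.inr 0)) with hxb
  set yb := mkA[n] (X (Sum.inl 0)) with hyb
  set zb := mkA[n] (X (Sum.inl 1)) with hzb
  have hrel' : zb * yb + xb ^ (n + 1) = 0 := by rw [mul_comm zb yb]; exact An_rel k n
  have hgen' : Algebra.adjoin k {xb, zb, yb} = ⊤ := by
    rw [← adjoin_mk_X_eq_top k gA[n]]
    congr 1; ext q; simp only [Set.mem_insert_iff, Set.mem_singleton_iff]; tauto
  set u₀ := algebraMap (MvPolynomial (Fin 2) k)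
    (Localization.Away (MvPolynomial.X 0 : MvPolynomial (Fin 2) k)) (X 0) with hu₀
  set u₁ := algebraMap (MvPolynomial (Fin 2) k)
    (Localization.Away (MvPolynomial.X 0 : MvPolynomial (Fin 2) k)) (X 1) with hu₁
  set θz₀ : MvPolynomial (Fin 2 ⊕ Fin 1) k →ₐ[k]
      Localization.Away (MvPolynomial.X 0 : MvPolynomial (Fin 2) k) :=
    aeval (Sum.elim ![-(u₁ ^ (n + 1) * u₀ ^ n), u₀] ![u₁ * u₀]) with hθz₀
  have hθz₀y : θz₀ (X (Sum.inl 0)) = -(u₁ ^ (n + 1) * u₀ ^ n) := by simp [hθz₀]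
  have hθz₀z : θz₀ (X (Sum.inl 1)) = u₀ := by simp [hθz₀]
  have hθz₀x : θz₀ (X (Sum.inr 0)) = u₁ * u₀ := by simp [hθz₀]
  have hθz₀g : θz₀ gA[n] = 0 := by
    rw [map_add, map_mul, hθz₀y, hθz₀z, aeval_rename, map_pow, Function.comp_def, aeval_X,
      Sum.elim_inr, Matrix.cons_val_zero]
    ring
  set θz := Ideal.Quotient.liftₐ (Ideal.span {gA[n]}) θz₀ (An_lift_aux k n θz₀ hθz₀g) with hθz
  have hθz_mk : ∀ s, θz (mkA[n] s) = θz₀ s := fun s =>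
    AlgHom.congr_fun (Ideal.Quotient.liftₐ_comp (Ideal.span {gA[n]}) θz₀
      (An_lift_aux k n θz₀ hθz₀g)) s
  have hset : ({xb, yb, zb} : Set RA[n]) = {xb, zb, yb} := by
    ext q; simp only [Set.mem_insert_iff, Set.mem_singleton_iff]; tauto
  rw [hset]
  refine stub_chart_graph_pow k RA[n] n hn xb zb yb hrel' hgen' θz ?_ ?_ ?_
  · rw [hzb, hθz_mk, hθz₀z]
  · rw [hxb, hθz_mk, hθz₀x, map_mul]
  · rw [hyb, hθz_mk, hθz₀y, map_mul, map_pow, map_pow]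

/-- **The graph charts of the blow-up of `Aₙ` at the origin are regular** (`n ≥ 1`): with
`I = (x̄, ȳ, z̄)`, both `Rₙ[I/ȳ]` and `Rₙ[I/z̄]` are regular rings (affine planes). [folklore] -/
theorem An_graphChart_isRegularRing (n : ℕ) (hn : 1 ≤ n) :
    IsRegularRing (blowupAlgebra (Ideal.span {mkA[n] (X (Sum.inr 0)), mkA[n] (X (Sum.inl 0)),
        mkA[n] (X (Sum.inl 1))}) (mkA[n] (X (Sum.inl 0)))) ∧
      IsRegularRing (blowupAlgebra (Ideal.span {mkA[n] (X (Sum.inr 0)), mkA[n] (X (Sum.inl 0)),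
        mkA[n] (X (Sum.inl 1))}) (mkA[n] (X (Sum.inl 1)))) :=
  ⟨An_graphChart_isRegularRing_y k n hn, An_graphChart_isRegularRing_z k n hn⟩

/-- **The blow-up of the origin is an isomorphism over its complement `Uₙ`** (Stacks 02OS for the
three generators, glued). Stated for any ideal of `Rₙ` containing `ȳ, z̄, x̄`. [folklore] -/
theorem An_isIso_affineBlowup_restrict_offOrigin (n : ℕ) (I : Ideal RA[n])
    (hy : mkA[n] (X (Sum.inl 0)) ∈ I) (hz : mkA[n] (X (Sum.inl 1)) ∈ I)
    (hx : mkA[n] (X (Sum.inr 0)) ∈ I) :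
    IsIso (affineBlowup.π I ∣_ UA[n]) :=
  isIso_morphismRestrict_sup _ (isIso_morphismRestrict_sup _
    (affineBlowup.isIso_morphismRestrict (I := I) _ hy)
    (affineBlowup.isIso_morphismRestrict (I := I) _ hz))
    (affineBlowup.isIso_morphismRestrict (I := I) _ hx)

/-- **The preimage of `Uₙ` under the blow-up is dense** (already `π⁻¹ D(ȳ)` is, `ȳ ≠ 0` in the
domain `Rₙ`). [folklore] -/
theorem An_dense_preimage_offOrigin (n : ℕ) (I : Ideal RA[n]) (hy : mkA[n] (X (Sum.inl 0)) ∈ I) :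
    Dense ((affineBlowup.π I ⁻¹ᵁ UA[n] : (affineBlowup I).Opens) : Set (affineBlowup I)) := by
  haveI := An_isDomain k n
  have hy0 : mkA[n] (X (Sum.inl 0)) ≠ 0 := fun h0 =>
    X_inl_zero_notMem_span_suspensionPow k n (Ideal.Quotient.eq_zero_iff_mem.mp h0)
  refine (affineBlowup.dense_preimage_basicOpen (I := I) _ hy hy0).mono ?_
  intro p hp
  exact Or.inl (Or.inl hp)

/-- The complement of the origin `Uₙ` is dense in `Aₙ`. [folklore] -/
theorem An_dense_offOrigin (n : ℕ) :
    Dense ((UA[n] : (Spec (CommRingCat.of RA[n])).Opens) : Set (Spec (CommRingCat.of RA[n]))) := by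
  refine (An_dense_basicOpen_X_inl_zero k n).mono ?_
  intro p hp
  exact Or.inl (Or.inl hp)

/-- **`P(n)` implies a resolution of singularities of `Aₙ`**: a proper morphism from a regular
scheme which is an isomorphism over the dense open `Uₙ` with dense preimage is proper
birational. [folklore] -/
theorem An_hasResolution_of_offOrigin_resolution (n : ℕ)
    (h : ∃ (X' : Scheme.{0}) (π : X' ⟶ Spec (CommRingCat.of RA[n])), IsProper π ∧
      Scheme.IsRegular X' ∧ IsIso (π ∣_ UA[n]) ∧ Dense ((π ⁻¹ᵁ UA[n] : X'.Opens) : Set X')) :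
    Scheme.HasResolution (Spec (CommRingCat.of RA[n])) := by
  obtain ⟨X', π, hπ, hreg, hiso, hd⟩ := h
  exact ⟨X', π, ⟨hπ, ⟨_, An_dense_offOrigin k n, hd, hiso⟩, hreg⟩⟩

/-- Stalks of open subschemes covered by regular charts: if every point of the open `W ⊆ X` lies in
the range of an open immersion from a regular scheme, then `W` is a regular scheme. [folklore] -/
theorem isRegular_opens_of_forall_exists {X : Scheme.{0}} (W : X.Opens)
    (h : ∀ x ∈ W, ∃ (U : Scheme.{0}) (j : U ⟶ X), IsOpenImmersion j ∧ x ∈ Set.range j ∧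
      Scheme.IsRegular U) : Scheme.IsRegular (W : Scheme.{0}) := by
  intro w
  obtain ⟨U, j, _, ⟨u, hu⟩, hU⟩ := h (W.ι w) w.2
  haveI := hU u
  have h1 : IsRegularLocalRing (X.presheaf.stalk (j u)) :=
    IsRegularLocalRing.of_ringEquiv (asIso (j.stalkMap u)).commRingCatIsoToRingEquiv.symm
  have h2 : IsRegularLocalRing (X.presheaf.stalk (W.ι w)) := by rw [← hu]; exact h1
  haveI := h2
  exact IsRegularLocalRing.of_ringEquiv (asIso (W.ι.stalkMap w)).commRingCatIsoToRingEquiv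

/-- The range of the chart `Spec (R[It])_{(bt)} → Bl_I(Spec R)` is `D₊(bt)` (Mathlib
`Proj.opensRange_awayι`, restated for the tree's `affineBlowup.chartι`). [folklore] -/
theorem chartι_opensRange_eq {R : Type} [CommRing R] (I : Ideal R) (b : R) (hb : b ∈ I) :
    (affineBlowup.chartι (I := I) b hb).opensRange = Proj.basicOpen (reesGrading I) (reesT b hb) :=
  Proj.opensRange_awayι _ _ _ _

/-- The preimage of the chart `D₊(ct)` under the chart immersion of `D₊(bt)` is the basic open of
the transition element `ct/bt` (Mathlib `Proj.awayι_preimage_basicOpen`, restated for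
`affineBlowup.chartι`). [folklore] -/
theorem chartι_preimage_basicOpen_eq {R : Type} [CommRing R] (I : Ideal R) (b : R) (hb : b ∈ I)
    (c : R) (hc : c ∈ I) :
    affineBlowup.chartι (I := I) b hb ⁻¹ᵁ Proj.basicOpen (reesGrading I) (reesT c hc) =
      PrimeSpectrum.basicOpen (HomogeneousLocalization.Away.isLocalizationElem (reesT_mem b hb)
        (reesT_mem c hc)) :=
  Proj.awayι_preimage_basicOpen _ (reesT_mem b hb) one_pos (reesT_mem c hc) one_pos

/-- A chart of the blow-up with regular chart ring is a regular open piece: every point of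
`D₊(bt)` lies in the range of an open immersion from a regular scheme. [folklore] -/
theorem affineBlowup_chart_regular_piece {R : Type} [CommRing R] (I : Ideal R) (b : R) (hb : b ∈ I)
    (hB : IsRegularRing (blowupAlgebra I b)) (p : affineBlowup I)
    (hp : p ∈ Proj.basicOpen (reesGrading I) (reesT b hb)) :
    ∃ (U : Scheme.{0}) (j : U ⟶ affineBlowup I), IsOpenImmersion j ∧ p ∈ Set.range j ∧
      Scheme.IsRegular U := by
  haveI := hB
  haveI : IsRegularRing (CommRingCat.of (HomogeneousLocalization.Away (reesGrading I) (reesT b hb))) :=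
    IsRegularRing.of_ringEquiv (reesChartEquiv b hb).symm
  refine ⟨_, affineBlowup.chartι (I := I) b hb, inferInstance, ?_, Scheme.isRegular_Spec _⟩
  rw [← Scheme.Hom.coe_opensRange, chartι_opensRange_eq I b hb]
  exact hp

/-- `P(1)` for the quadric cone, notation form (see `An_offOrigin_resolution_one`). [folklore] -/
theorem An_offOrigin_resolution_one_aux :
    ∃ (X' : Scheme.{0}) (π : X' ⟶ Spec (CommRingCat.of RA[1])), IsProper π ∧
      Scheme.IsRegular X' ∧ IsIso (π ∣_ UA[1]) ∧ Dense ((π ⁻¹ᵁ UA[1] : X'.Opens) : Set X') := by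
  set xb := mkA[1] (X (Sum.inr 0)) with hxb
  set yb := mkA[1] (X (Sum.inl 0)) with hyb
  set zb := mkA[1] (X (Sum.inl 1)) with hzb
  have hrel : yb * zb + xb ^ 2 = 0 := An_rel k 1
  obtain ⟨hBy, hBz⟩ := An_graphChart_isRegularRing k 1 le_rfl
  set v : Fin 3 → RA[1] := ![yb, zb, xb] with hv
  have hIv : Ideal.span (Set.range v) = Ideal.span {xb, yb, zb} := by
    congr 1
    ext q
    simp only [hv, Matrix.range_cons, Matrix.range_empty, Set.union_empty, Set.union_singleton,
      Set.mem_insert_iff, Set.mem_singleton_iff, Set.mem_union]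
    tauto
  have hyI : yb ∈ Ideal.span (Set.range v) := Ideal.subset_span ⟨0, rfl⟩
  have hzI : zb ∈ Ideal.span (Set.range v) := Ideal.subset_span ⟨1, rfl⟩
  have hxI : xb ∈ Ideal.span (Set.range v) := Ideal.subset_span ⟨2, rfl⟩
  have hreg : Scheme.IsRegular (affineBlowup (Ideal.span (Set.range v))) := by
    refine Scheme.IsRegular.of_forall_exists_isOpenImmersion fun p => ?_
    have hp : p ∈ (⨆ i : Fin 3, Proj.basicOpen (reesGrading (Ideal.span (Set.range v)))
        (reesT (v i) (Ideal.mem_span_range_self (f := v) (x := i)))) := by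
      rw [affineBlowup.iSup_basicOpen_reesT_generators_eq_top v]; trivial
    obtain ⟨i, hi⟩ := Opens.mem_iSup.mp hp
    have hyz : p ∈ Proj.basicOpen (reesGrading (Ideal.span (Set.range v))) (reesT yb hyI) ∨
        p ∈ Proj.basicOpen (reesGrading (Ideal.span (Set.range v))) (reesT zb hzI) := by
      fin_cases i
      · exact Or.inl hi
      · exact Or.inr hi
      · exact Or.inl (stub_cover_sq _ _ xb yb zb hxI hyI hzI hrel hi)
    rcases hyz with h | h
    · exact affineBlowup_chart_regular_piece _ yb hyI (by rw [hIv]; exact hBy) p h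
    · exact affineBlowup_chart_regular_piece _ zb hzI (by rw [hIv]; exact hBz) p h
  haveI : IsNoetherianRing RA[1] := inferInstance
  exact ⟨_, affineBlowup.π _, inferInstance, hreg,
    An_isIso_affineBlowup_restrict_offOrigin k 1 _ hyI hzI hxI,
    An_dense_preimage_offOrigin k 1 _ hyI⟩

/-- The derivative of the equation of `A₀ = {yz + x = 0}` in `x` is `1`. [folklore] -/
theorem pderiv_inr_gA_zero :
    pderiv (Sum.inr 0) gA[0] = 1 := by
  simp [pderiv_X, map_add, Derivation.leibniz, rename_X]

/-- **`A₀ = {yz + x = 0}` is a regular scheme** (the equation has derivative `1` in `x`, so at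
every prime it lies outside the square of the maximal ideal: `algebraMap_notMem_maximalIdeal_sq`,
`IsRegularLocalRing.quotient_span_singleton`). [folklore] -/
theorem An_zero_isRegular : Scheme.IsRegular (Spec (CommRingCat.of RA[0])) := by
  intro p
  haveI hPprime : (p.asIdeal.comap mkA[0]).IsPrime := Ideal.comap_isPrime _ _
  have hgP : gA[0] ∈ p.asIdeal.comap mkA[0] := by
    rw [Ideal.mem_comap, Ideal.Quotient.eq_zero_iff_mem.mpr (Ideal.mem_span_singleton_self _)]
    exact zero_mem _
  have hmem : algebraMap (MvPolynomial (Fin 2 ⊕ Fin 1) k) (Localization.AtPrime (p.asIdeal.comap mkA[0]))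
      gA[0] ∈ IsLocalRing.maximalIdeal (Localization.AtPrime (p.asIdeal.comap mkA[0])) := by
    rw [← Localization.AtPrime.map_eq_maximalIdeal]
    exact Ideal.mem_map_of_mem _ hgP
  have hsq := algebraMap_notMem_maximalIdeal_sq (p.asIdeal.comap mkA[0])
    (pderiv (Sum.inr 0) : Derivation k (MvPolynomial (Fin 2 ⊕ Fin 1) k) _) hgP
    (by rw [pderiv_inr_gA_zero]; exact (Ideal.ne_top_iff_one _).mp (Ideal.IsPrime.ne_top inferInstance))
  have hreg := (IsRegularLocalRing.quotient_span_singleton hmem hsq).1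
  obtain ⟨e⟩ := nonempty_stalk_ringEquiv_localization_quotient _ gA[0] p _ rfl
  haveI := hreg
  exact IsRegularLocalRing.of_ringEquiv e.symm

/-- **`P(0)`**: `A₀` is regular, so the identity is the required morphism. [folklore] -/
theorem An_offOrigin_resolution_zero :
    ∃ (X' : Scheme.{0}) (π : X' ⟶ Spec (CommRingCat.of RA[0])), IsProper π ∧
      Scheme.IsRegular X' ∧ IsIso (π ∣_ UA[0]) ∧ Dense ((π ⁻¹ᵁ UA[0] : X'.Opens) : Set X') := by
  refine ⟨_, 𝟙 _, inferInstance, An_zero_isRegular k, inferInstance, ?_⟩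
  exact An_dense_offOrigin k 0

end AnBase

/-- **`P(1)`: the quadric cone.** For every field `k`, the blow-up of `A₁ = Spec k[y,z,x]/(yz + x²)`
at the origin is a proper morphism from a REGULAR scheme (graph charts affine planes, the `x`-chart
covered by the `y`-chart) which is an isomorphism over the complement `D(ȳ) ∪ D(z̄) ∪ D(x̄)` of the
origin, with dense preimage of that complement. Registered stub of crux
stmt-ResolutionOfSingularities-15317 (line `Sketch`, `A_n` programme). [folklore; Kollár 2007 §2.2] -/
theorem An_offOrigin_resolution_one (k : Type) [Field k] :
    ∃ (X' : Scheme.{0}) (π : X' ⟶ Spec (CommRingCat.of (MvPolynomial (Fin 2 ⊕ Fin 1) k ⧸ Ideal.span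
      {(MvPolynomial.X (Sum.inl 0) * MvPolynomial.X (Sum.inl 1) +
          MvPolynomial.rename Sum.inr (MvPolynomial.X 0 ^ (1 + 1)) : MvPolynomial (Fin 2 ⊕ Fin 1) k)}))),
      IsProper π ∧ Scheme.IsRegular X' ∧ IsIso (π ∣_ ((PrimeSpectrum.basicOpen (Ideal.Quotient.mk (Ideal.span {(MvPolynomial.X (Sum.inl 0) * MvPolynomial.X (Sum.inl 1) +
          MvPolynomial.rename Sum.inr (MvPolynomial.X 0 ^ (1 + 1)) : MvPolynomial (Fin 2 ⊕ Fin 1) k)}) (MvPolynomial.X (Sum.inl 0))) ⊔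
        PrimeSpectrum.basicOpen (Ideal.Quotient.mk (Ideal.span {(MvPolynomial.X (Sum.inl 0) * MvPolynomial.X (Sum.inl 1) +
          MvPolynomial.rename Sum.inr (MvPolynomial.X 0 ^ (1 + 1)) : MvPolynomial (Fin 2 ⊕ Fin 1) k)}) (MvPolynomial.X (Sum.inl 1))) ⊔
        PrimeSpectrum.basicOpen (Ideal.Quotient.mk (Ideal.span {(MvPolynomial.X (Sum.inl 0) * MvPolynomial.X (Sum.inl 1) +
          MvPolynomial.rename Sum.inr (MvPolynomial.X 0 ^ (1 + 1)) : MvPolynomial (Fin 2 ⊕ Fin 1) k)}) (MvPolynomial.X (Sum.inr 0)))) :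
        (Spec (CommRingCat.of (MvPolynomial (Fin 2 ⊕ Fin 1) k ⧸ Ideal.span {(MvPolynomial.X (Sum.inl 0) * MvPolynomial.X (Sum.inl 1) +
          MvPolynomial.rename Sum.inr (MvPolynomial.X 0 ^ (1 + 1)) : MvPolynomial (Fin 2 ⊕ Fin 1) k)}))).Opens)) ∧
      Dense ((π ⁻¹ᵁ ((PrimeSpectrum.basicOpen (Ideal.Quotient.mk (Ideal.span {(MvPolynomial.X (Sum.inl 0) * MvPolynomial.X (Sum.inl 1) +
          MvPolynomial.rename Sum.inr (MvPolynomial.X 0 ^ (1 + 1)) : MvPolynomial (Fin 2 ⊕ Fin 1) k)}) (MvPolynomial.X (Sum.inl 0))) ⊔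
        PrimeSpectrum.basicOpen (Ideal.Quotient.mk (Ideal.span {(MvPolynomial.X (Sum.inl 0) * MvPolynomial.X (Sum.inl 1) +
          MvPolynomial.rename Sum.inr (MvPolynomial.X 0 ^ (1 + 1)) : MvPolynomial (Fin 2 ⊕ Fin 1) k)}) (MvPolynomial.X (Sum.inl 1))) ⊔
        PrimeSpectrum.basicOpen (Ideal.Quotient.mk (Ideal.span {(MvPolynomial.X (Sum.inl 0) * MvPolynomial.X (Sum.inl 1) +
          MvPolynomial.rename Sum.inr (MvPolynomial.X 0 ^ (1 + 1)) : MvPolynomial (Fin 2 ⊕ Fin 1) k)}) (MvPolynomial.X (Sum.inr 0)))) :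
        (Spec (CommRingCat.of (MvPolynomial (Fin 2 ⊕ Fin 1) k ⧸ Ideal.span {(MvPolynomial.X (Sum.inl 0) * MvPolynomial.X (Sum.inl 1) +
          MvPolynomial.rename Sum.inr (MvPolynomial.X 0 ^ (1 + 1)) : MvPolynomial (Fin 2 ⊕ Fin 1) k)}))).Opens) : X'.Opens) : Set X') :=
  An_offOrigin_resolution_one_aux k


end Summit.ResolutionOfSingularities.ResolutionOfSingularities.Theorems.FRationalResolution

end
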